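/-
Copyright: the b2b-balaban cell (near-miss cell 7), T⁴-continuum fan-out; row NE7b ROUND-2 swarm, seat
t4-ne7b-formalise-leaf-02 (gen 6) — supplier piece for the S6g′ INSTANCE's T3b «injection», step T3b-3 (owner's
rulings R-OWNER-23-3…-7, holder leaf-05 g4): binary contact along a cluster ⇒ the order-free datum `PhysTop` of part 2″
(journal OFFER l.13969).  A supplier module consumed BY NAME; not a claim of T3b-3.  Released under the licence of the surrounding project.
-/
import Summits.QuantumFields.BalabanUV.T4Continuum.Support.HistoryZoneMassBridge
import Summits.QuantumFields.BalabanUV.T4Continuum.Support.HistoryJoinsRearrange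

/-!
# Cluster contact: BINARY CONTACT at every merge node of a cluster ⇒ touch-connected parts ⇒ `PhysTop` (clause 1)

Summits-side support leaf of the T⁴-continuum cell (rung (B)+1 on a FINITE torus only; NOT infinite volume, NOT the
mass gap, NOT the Clay statement; NOT a proof of the spine estimate NE7b).  Row NE7b, route «COUNT», row S6g′
INSTANCE, piece T3b, step T3b-3 of the holder's plan (journal l.13853): «generic — binary contact at every merge node
of a cluster ⇒ `TConn` of its parts».  Part 2″ `HistoryJoinsRearrange.exists_rearranged_mem_S` asks, at every join,
the ORDER-FREE datum `PhysTop`: (1) the `touch0` graph of the placed parts reaches every part from the host, (2) two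
distinct equal-shape parts read different births.  A realised member supplies contact in BINARY form — at each merger
of the cluster the two partners' current images touch — and this file turns (binary contact of SOME part of the first
partner's cluster with SOME part of the second's, at every same-step merge node) into (1).  [folklore] finite list ∕
tree combinatorics over the lineage's own carriers (`clusterParts`, `jparts`, `part`, leaf-04 g3's `TConn`); nothing
is quoted from print, nothing printed is asserted, no `[cite:]` tag, no named fact (ONE predicate WITH parameters,
`BinContact`).  Imports leaf-04 g3's `HistoryZoneMassBridge` (`HistoryZoneMassPieces.TConn`, `TConn.map`) and part 2″.

WHAT.  §1 lists: `reflTransGen_mono_append_left∕right`, `tconn_of_mem_iff` (members only — permutation-invariant),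
`tconn_of_tconn_map` (pull-back along a map, converse of `TConn.map`),
**`tconn_append_of_bridge`** (two touch-connected lists with
ONE symmetric bridge between them concatenate to a touch-connected list).  §2 **`BinContact st t T G`** (structural:
at a merger of step `t`, `BinContact` of both partners for the relations shifted by `false`∕`true`, and SOME step-`t`
cluster part of the first partner `T`-related to SOME of the second; `True` elsewhere), `binContact_merge_iff`,
`BinContact.mono`,
**`tconn_clusterParts_of_binContact`** (`T` symmetric), `tconn_jparts_of_binContact`.  §3 indices:
**`reachable_of_tconn`** (`TConn T (jparts st (merge X Y e))` ⇒ every two part INDICES are joined in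
`SimpleGraph.fromRel fun i j => T (part i) (part j)`), **`physTop_of_tconn`**, **`physTop_of_binContact`** — with
`T p q := (zone (st e) p.2 (rel c₀ p.1 P) ∩ zone (st e) q.2 (rel c₀ q.1 P)).Nonempty` (which IS `touch0 … i (cfg … P i) j
(cfg … P j)` on indices), binary contact along the top cluster + the distinct-births clause ⇒ `PhysTop c₀ st zone
(merge X Y e) P`; **`allJoins_physTop_of_binContact`** assembles part 2″'s `hA : AllJoins c₀ st (PhysTop c₀ st zone) G P`
join by join.  §4 sanity.

HONEST SCOPE.  The H3-facing half of T3b-3 — realised binary contact of the partners' images (leaf-07 g2's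
`contact_of_corr`), «a partner's image lies in the union of its cluster parts' zones», the transport to the sorted twin
— is the holder's, NOT here; clause (2) of `PhysTop` is the holder's displayed `hdis` (F-leaf05g4-1).  Nothing of
H3∕(B)∕BetaPertH touched; `hdis`∕`hmult`∕`resum`∕`BirthShapeNodup` NOT retired by this file; NE7b NOT proved; spine 0∕9.
HONEST DEPENDENCY (cell): continuum YM on T⁴ ⇐ BetaPertH ∧ nine spine estimates (0/9 proved); BetaPertH ⇐ (D1) ∧ (D4)
∧ CAP+tail; G-an2-4 gates asym, D1 and NE2/3/4.  This file changes none of it.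
-/

open Finset
open Literature.MathematicalPhysics.QuantumFieldTheory.Balaban1983to89
open T4PersistenceDictionary T4PartnerMultiplicity T4BranchingRecordsGas
open Summit.QuantumFields.BalabanUV.T4Continuum.HistoryZoneMassPieces
open Summit.QuantumFields.BalabanUV.T4Continuum.HistoryZoneMassBridge
open Summit.QuantumFields.BalabanUV.T4Continuum.HistoryJoins
open Summit.QuantumFields.BalabanUV.T4Continuum.HistoryJoinsAdm
open Summit.QuantumFields.BalabanUV.T4Continuum.HistoryJoinsTag
open Summit.QuantumFields.BalabanUV.T4Continuum.HistoryJoinsGlue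
open Summit.QuantumFields.BalabanUV.T4Continuum.HistoryJoinsRearrange

namespace Summit.QuantumFields.BalabanUV.T4Continuum.HistoryJoinsClusterContact

/-! ## §1 Concatenating touch-connected lists along one bridge -/

section Lists

variable {α : Type*} {T : α → α → Prop}

/-- a chain inside `l₁` is a chain inside `l₁ ++ l₂` [folklore] -/
theorem reflTransGen_mono_append_left (l₁ l₂ : List α) {p q : α}
    (h : Relation.ReflTransGen (fun a b => a ∈ l₁ ∧ b ∈ l₁ ∧ T a b) p q) :
    Relation.ReflTransGen (fun a b => a ∈ l₁ ++ l₂ ∧ b ∈ l₁ ++ l₂ ∧ T a b) p q :=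
  Relation.ReflTransGen.mono
    (fun _ _ hab => ⟨List.mem_append_left _ hab.1, List.mem_append_left _ hab.2.1, hab.2.2⟩) _ _ h

/-- a chain inside `l₂` is a chain inside `l₁ ++ l₂` [folklore] -/
theorem reflTransGen_mono_append_right (l₁ l₂ : List α) {p q : α}
    (h : Relation.ReflTransGen (fun a b => a ∈ l₂ ∧ b ∈ l₂ ∧ T a b) p q) :
    Relation.ReflTransGen (fun a b => a ∈ l₁ ++ l₂ ∧ b ∈ l₁ ++ l₂ ∧ T a b) p q :=
  Relation.ReflTransGen.mono
    (fun _ _ hab => ⟨List.mem_append_right _ hab.1, List.mem_append_right _ hab.2.1, hab.2.2⟩) _ _ h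

/-- touch-connectedness depends on the list only through its members (e.g. it is invariant under permutations)
[folklore] -/
theorem tconn_of_mem_iff {l l' : List α} (h : ∀ x, x ∈ l' ↔ x ∈ l) (hc : TConn T l) : TConn T l' :=
  fun p hp q hq =>
    Relation.ReflTransGen.mono (fun _ _ hab => ⟨(h _).2 hab.1, (h _).2 hab.2.1, hab.2.2⟩) _ _
      (hc p ((h p).1 hp) q ((h q).1 hq))

/-- **PULLING TOUCH-CONNECTEDNESS BACK ALONG A MAP** (converse of leaf-04 g3's `TConn.map`): if the IMAGES `l.map f`
are touch-connected for `T'` and every member's image touches itself (e.g. zones: non-empty), then `l` is touch-connected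
for `T'` read through `f`.  (The T3b holder's listing-free `ClusterConn` is stated on mapped zone lists; this returns
to the part lists of `physTop_of_tconn`.) [folklore] -/
theorem tconn_of_tconn_map {β : Type*} {T' : β → β → Prop} (f : α → β) {l : List α}
    (hrefl : ∀ a ∈ l, T' (f a) (f a)) (hc : TConn T' (l.map f)) : TConn (fun a b => T' (f a) (f b)) l := by
  classical
  intro p hp q hq
  -- chains of images from `f p` pull back to chains of members from `p`, to ANY preimage of the endpoint
  have key : ∀ y, Relation.ReflTransGen (fun x y => x ∈ l.map f ∧ y ∈ l.map f ∧ T' x y) (f p) y →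
      ∀ b ∈ l, f b = y → Relation.ReflTransGen (fun a b => a ∈ l ∧ b ∈ l ∧ T' (f a) (f b)) p b := by
    intro y hy
    induction hy with
    | refl =>
        intro b hb hfb
        by_cases hbp : b = p
        · rw [hbp]
        · exact Relation.ReflTransGen.single ⟨hp, hb, by rw [hfb]; exact hrefl p hp⟩
    | tail _ hyz ih =>
        intro b hb hfb
        obtain ⟨a, ha, hfa⟩ := List.mem_map.1 hyz.1
        exact (ih a ha hfa).tail ⟨ha, hb, by rw [hfa, hfb]; exact hyz.2.2⟩
  exact key _ (hc _ (List.mem_map.2 ⟨p, hp, rfl⟩) _ (List.mem_map.2 ⟨q, hq, rfl⟩)) q hq rfl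

/-- **TWO TOUCH-CONNECTED LISTS WITH ONE (SYMMETRIC) BRIDGE CONCATENATE TO A TOUCH-CONNECTED LIST.** [folklore] -/
theorem tconn_append_of_bridge (hsymm : ∀ a b, T a b → T b a) {l₁ l₂ : List α} (h₁ : TConn T l₁)
    (h₂ : TConn T l₂) {a b : α} (ha : a ∈ l₁) (hb : b ∈ l₂) (hab : T a b) : TConn T (l₁ ++ l₂) := by
  -- the bridge, both ways, inside the concatenation
  have eab : Relation.ReflTransGen (fun x y => x ∈ l₁ ++ l₂ ∧ y ∈ l₁ ++ l₂ ∧ T x y) a b :=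
    Relation.ReflTransGen.single ⟨List.mem_append_left _ ha, List.mem_append_right _ hb, hab⟩
  have eba : Relation.ReflTransGen (fun x y => x ∈ l₁ ++ l₂ ∧ y ∈ l₁ ++ l₂ ∧ T x y) b a :=
    Relation.ReflTransGen.single ⟨List.mem_append_right _ hb, List.mem_append_left _ ha, hsymm _ _ hab⟩
  intro p hp q hq
  rw [List.mem_append] at hp hq
  rcases hp with hp | hp <;> rcases hq with hq | hq
  · exact reflTransGen_mono_append_left l₁ l₂ (h₁ p hp q hq)
  · exact ((reflTransGen_mono_append_left l₁ l₂ (h₁ p hp a ha)).trans eab).trans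
      (reflTransGen_mono_append_right l₁ l₂ (h₂ b hb q hq))
  · exact ((reflTransGen_mono_append_right l₁ l₂ (h₂ p hp b hb)).trans eba).trans
      (reflTransGen_mono_append_left l₁ l₂ (h₁ a ha q hq))
  · exact reflTransGen_mono_append_right l₁ l₂ (h₂ p hp q hq)

end Lists

/-! ## §2 Binary contact along a cluster -/

section Cluster

variable {ε : Type*} (st : ε → ℕ) (t : ℕ)

/-- **BINARY CONTACT ALONG THE STEP-`t` CLUSTER AT THE TOP OF `G`** for a relation `T` on (path, part) pairs (paths
relative to `G`): at a merger of step `t`, binary contact along both partners' clusters (for the relations shifted by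
the partner's address letter) AND some step-`t` cluster part of the first partner is `T`-related to some step-`t`
cluster part of the second; nothing is asked of a node that is not a step-`t` merger. [folklore] -/
def BinContact : ((List Bool × Gen ε) → (List Bool × Gen ε) → Prop) → Gen ε → Prop
  | T, Gen.merge X Y e =>
      st e = t →
        BinContact (fun p q => T (false :: p.1, p.2) (false :: q.1, q.2)) X ∧
          BinContact (fun p q => T (true :: p.1, p.2) (true :: q.1, q.2)) Y ∧
            ∃ p ∈ clusterParts st t X, ∃ q ∈ clusterParts st t Y, T (false :: p.1, p.2) (true :: q.1, q.2)
  | _, Gen.born _ _ => True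
  | _, Gen.renew _ _ _ => True

/-- nothing is asked of a bare birth [folklore] -/
@[simp] theorem binContact_born (T : (List Bool × Gen ε) → (List Bool × Gen ε) → Prop) (b : ε) (j : ℕ) :
    BinContact st t T (Gen.born b j) := trivial

/-- nothing is asked of a renewal [folklore] -/
@[simp] theorem binContact_renew (T : (List Bool × Gen ε) → (List Bool × Gen ε) → Prop) (G : Gen ε) (e : ε)
    (h : ℕ) :
    BinContact st t T (Gen.renew G e h) := trivial

/-- unfolding at a merger [folklore] -/
theorem binContact_merge_iff (T : (List Bool × Gen ε) → (List Bool × Gen ε) → Prop) (X Y : Gen ε) (e : ε) :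
    BinContact st t T (Gen.merge X Y e) ↔
      (st e = t →
        BinContact st t (fun p q => T (false :: p.1, p.2) (false :: q.1, q.2)) X ∧
          BinContact st t (fun p q => T (true :: p.1, p.2) (true :: q.1, q.2)) Y ∧
            ∃ p ∈ clusterParts st t X, ∃ q ∈ clusterParts st t Y, T (false :: p.1, p.2) (true :: q.1, q.2)) :=
  Iff.rfl

/-- nothing is asked of a merger of another step [folklore] -/
theorem binContact_merge_of_ne {T : (List Bool × Gen ε) → (List Bool × Gen ε) → Prop} {X Y : Gen ε} {e : ε}
    (he : st e ≠ t) : BinContact st t T (Gen.merge X Y e) :=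
  fun h => absurd h he

variable {st t}

/-- binary contact is monotone in the relation [folklore] -/
theorem BinContact.mono :
    ∀ (G : Gen ε) {T T' : (List Bool × Gen ε) → (List Bool × Gen ε) → Prop},
      (∀ p q, T p q → T' p q) → BinContact st t T G → BinContact st t T' G
  | Gen.born _ _, _, _, _, _ => trivial
  | Gen.renew _ _ _, _, _, _, _ => trivial
  | Gen.merge X Y e, T, T', hTT', hB => fun he => by
      obtain ⟨hX, hY, p, hp, q, hq, hpq⟩ := hB he
      exact ⟨BinContact.mono X (fun _ _ h => hTT' _ _ h) hX, BinContact.mono Y (fun _ _ h => hTT' _ _ h) hY,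
        p, hp, q, hq, hTT' _ _ hpq⟩

/-- **BINARY CONTACT ALONG THE CLUSTER ⇒ ITS PARTS ARE TOUCH-CONNECTED** (for a symmetric `T`). [folklore] -/
theorem tconn_clusterParts_of_binContact :
    ∀ (G : Gen ε) (T : (List Bool × Gen ε) → (List Bool × Gen ε) → Prop),
      (∀ p q, T p q → T q p) → BinContact st t T G → TConn T (clusterParts st t G)
  | Gen.born b j, T, _, _ => by simpa using tconn_singleton T ([], Gen.born b j)
  | Gen.renew G e h, T, _, _ => by simpa using tconn_singleton T ([], Gen.renew G e h)
  | Gen.merge X Y e, T, hsymm, hB => by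
      by_cases he : st e = t
      · obtain ⟨hX, hY, p, hp, q, hq, hpq⟩ := hB he
        rw [clusterParts_merge_of_eq st he]
        have h₁ : TConn T ((clusterParts st t X).map fun q => (false :: q.1, q.2)) :=
          TConn.map (fun q : List Bool × Gen ε => (false :: q.1, q.2)) (fun _ _ _ _ h => h)
            (tconn_clusterParts_of_binContact X _ (fun _ _ h => hsymm _ _ h) hX)
        have h₂ : TConn T ((clusterParts st t Y).map fun q => (true :: q.1, q.2)) :=
          TConn.map (fun q : List Bool × Gen ε => (true :: q.1, q.2)) (fun _ _ _ _ h => h)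
            (tconn_clusterParts_of_binContact Y _ (fun _ _ h => hsymm _ _ h) hY)
        exact tconn_append_of_bridge hsymm h₁ h₂ (List.mem_map.2 ⟨p, hp, rfl⟩) (List.mem_map.2 ⟨q, hq, rfl⟩) hpq
      · rw [clusterParts_merge_of_ne st he]
        exact tconn_singleton T _

/-- **… IN PARTICULAR THE PARTS OF THE TOP JOIN OF A MERGER** (binary contact along its own step's cluster). [folklore] -/
theorem tconn_jparts_of_binContact {T : (List Bool × Gen ε) → (List Bool × Gen ε) → Prop}
    (hsymm : ∀ p q, T p q → T q p) {X Y : Gen ε} {e : ε} (hB : BinContact st (st e) T (Gen.merge X Y e)) :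
    TConn T (jparts st (Gen.merge X Y e)) :=
  tconn_clusterParts_of_binContact (Gen.merge X Y e) T hsymm hB

end Cluster

/-! ## §3 The index level: `PhysTop` of part 2″ -/

section Indices

variable {ε : Type*} (st : ε → ℕ) (X Y : Gen ε) (e : ε)

/-- **TOUCH-CONNECTED PARTS ⇒ EVERY TWO PART INDICES ARE JOINED** in the graph `SimpleGraph.fromRel` of `T` read on
the indexed parts. [folklore] -/
theorem reachable_of_tconn {T : (List Bool × Gen ε) → (List Bool × Gen ε) → Prop}
    (h : TConn T (jparts st (Gen.merge X Y e))) (i j : Fin (npart st (Gen.merge X Y e))) :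
    (SimpleGraph.fromRel fun i j => T (part st _ i) (part st _ j)).Reachable i j := by
  -- chains of members lift to chains of indices
  have lift : ∀ (a b : List Bool × Gen ε),
      Relation.ReflTransGen
          (fun a b => a ∈ jparts st (Gen.merge X Y e) ∧ b ∈ jparts st (Gen.merge X Y e) ∧ T a b) a b →
        ∀ k l : Fin (npart st (Gen.merge X Y e)), part st _ k = a → part st _ l = b →
          (SimpleGraph.fromRel fun i j => T (part st _ i) (part st _ j)).Reachable k l := by
    intro a b hab
    induction hab with
    | refl =>
        intro k l hk hl
        rw [part_injective st _ (hk.trans hl.symm)]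
    | tail _ hbc ih =>
        intro k l hk hl
        obtain ⟨m, hm⟩ := exists_part_eq st hbc.1
        refine (ih k m hk hm).trans ?_
        by_cases hml : m = l
        · rw [hml]
        · refine SimpleGraph.Adj.reachable ?_
          rw [SimpleGraph.fromRel_adj]
          exact ⟨hml, Or.inl (by rw [hm, hl]; exact hbc.2.2)⟩
  exact lift _ _ (h _ (part_mem st _ i) _ (part_mem st _ j)) i j rfl rfl

variable {β γ : Type*} [DecidableEq β] {D : ℕ} (c₀ : γ) (zone : ℕ → Gen ε → (Addr D → γ) → Finset β)

/-- **`PhysTop` FROM TOUCH-CONNECTED PARTS**: if the parts of the top join, placed by `P`, are touch-connected for «zones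
at the join step share a block», and distinct equal-shape parts read different births, then `PhysTop` holds.
[folklore] -/
theorem physTop_of_tconn {P : Addr D → γ}
    (hT : TConn (fun p q => (zone (st e) p.2 (rel c₀ p.1 P) ∩ zone (st e) q.2 (rel c₀ q.1 P)).Nonempty)
      (jparts st (Gen.merge X Y e)))
    (hd : ∀ i j, key st X Y e i = key st X Y e j → i ≠ j →
      bread c₀ (part st _ i).2 (cfg c₀ st X Y e P i) ≠ bread c₀ (part st _ j).2 (cfg c₀ st X Y e P j)) :
    PhysTop c₀ st zone (Gen.merge X Y e) P :=
  ⟨fun i => reachable_of_tconn st X Y e hT (hostIdx st X Y e) i, hd⟩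

/-- **`PhysTop` FROM BINARY CONTACT ALONG THE TOP CLUSTER** — the shape T3b-3 produces from a realised member: at every
same-step merge node of the top cluster some part below the first partner and some part below the second have zones
sharing a block (paths relative to the merger, placements read through `rel`), plus the distinct-births clause.
[folklore] -/
theorem physTop_of_binContact {P : Addr D → γ}
    (hB : BinContact st (st e)
      (fun p q => (zone (st e) p.2 (rel c₀ p.1 P) ∩ zone (st e) q.2 (rel c₀ q.1 P)).Nonempty) (Gen.merge X Y e))
    (hd : ∀ i j, key st X Y e i = key st X Y e j → i ≠ j →
      bread c₀ (part st _ i).2 (cfg c₀ st X Y e P i) ≠ bread c₀ (part st _ j).2 (cfg c₀ st X Y e P j)) :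
    PhysTop c₀ st zone (Gen.merge X Y e) P :=
  physTop_of_tconn st X Y e c₀ zone
    (tconn_jparts_of_binContact
      (fun p q (h : (zone (st e) p.2 (rel c₀ p.1 P) ∩ zone (st e) q.2 (rel c₀ q.1 P)).Nonempty) => by
        rwa [inter_comm] at h) hB) hd

/-- **`AllJoins … (PhysTop …)` FROM BINARY CONTACT AT EVERY JOIN**: the hypothesis `hA` of part 2″'s
`exists_rearranged_mem_S` for a placement `P` of `G`, assembled join by join (each join `(a, merge X Y e) ∈ croots st G`
read through its path `a`). [folklore] -/
theorem allJoins_physTop_of_binContact {G : Gen ε} {P : Addr D → γ}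
    (h : ∀ (a : List Bool) (X Y : Gen ε) (e : ε), (a, Gen.merge X Y e) ∈ croots st G →
      BinContact st (st e)
          (fun p q => (zone (st e) p.2 (rel c₀ p.1 (rel c₀ a P)) ∩ zone (st e) q.2 (rel c₀ q.1 (rel c₀ a P))).Nonempty)
          (Gen.merge X Y e) ∧
        ∀ i j, key st X Y e i = key st X Y e j → i ≠ j →
          bread c₀ (part st _ i).2 (cfg c₀ st X Y e (rel c₀ a P) i) ≠
            bread c₀ (part st _ j).2 (cfg c₀ st X Y e (rel c₀ a P) j)) :
    AllJoins c₀ st (PhysTop c₀ st zone) G P := by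
  intro q hq
  obtain ⟨X, Y, e, hXY⟩ := exists_eq_merge_of_mem_crootsP st none G q hq
  obtain ⟨a, W⟩ := q
  simp only at hXY
  subst hXY
  obtain ⟨hB, hd⟩ := h a X Y e hq
  exact physTop_of_binContact st X Y e c₀ zone hB hd

end Indices

/-! ## §4 Sanity -/

namespace Sanity

/-- three births merged at one step, `((a b) c)`, with contact only between `b` and `c` and between `a` and `b`
(a path, read on the labels): binary contact holds along the cluster, so the three parts are touch-connected although
`a` and `c` do not touch -/
example : TConn (fun p q : List Bool × Gen ℕ => (p.2.root + 1 = q.2.root) ∨ (q.2.root + 1 = p.2.root))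
    (clusterParts (fun _ : ℕ => 0) 0
      (Gen.merge (Gen.merge (Gen.born 0 0) (Gen.born 1 0) 7) (Gen.born 2 0) 8)) := by
  refine tconn_clusterParts_of_binContact _ _ (fun p q h => h.symm) ?_
  refine fun _ => ⟨fun _ => ⟨trivial, trivial, ([], Gen.born 0 0), by simp, ([], Gen.born 1 0), by simp, ?_⟩, trivial,
    ([true], Gen.born 1 0), ?_, ([], Gen.born 2 0), by simp, ?_⟩
  · simp [Gen.root]
  · simp [clusterParts_merge_of_eq (fun _ : ℕ => 0) rfl]
  · simp [Gen.root]

end Sanity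

end Summit.QuantumFields.BalabanUV.T4Continuum.HistoryJoinsClusterContact
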